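import Summits.AtomisticToContinuum.Crystallization.Theorems.OverbindingBudgetAffineRunCutB

/-!
# NODE g78 «RunCut» — PART C (final): §5 the fault zone refined — run ends reduce to run interiors by shadow packing (PROVED); the thin-fault gas
is the typed residual; the sharp lossless forms `HI ⟺ RunInterior ∧ ThinFault ⟺ RigidRunExchange ∧ CompressedRun ∧ WildRun ∧ ThinFault` and the record cones.

See PART A (`…OverbindingBudgetAffineRunCutA`) for the module documentation of the node; this part continues the same namespace.
-/

namespace Summit.AtomisticToContinuum.Crystallization.Theorems.OverbindingBudgetAffineRunCut

open scoped BigOperators Classical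
open Literature.MathematicalPhysics.StatisticalMechanics
open Literature.Geometry.DiscreteGeometry (IsChargeFree nearestDist nearestDist_nonneg nearestDist_le_dist fccTwoShellPattern hcpTwoShellPattern)
open Summit.AtomisticToContinuum.Crystallization.Theorems.OverbindingBudgetMisfitRegistration (Framed Reg DeepReg)
open Summit.AtomisticToContinuum.Crystallization.Theorems.OverbindingBudgetMisfitWindowStatements (InWindow offCount)
open Summit.AtomisticToContinuum.Crystallization.Theorems.OverbindingBudgetMisfitCensusStatements (card_le_of_cube)
open Summit.AtomisticToContinuum.Crystallization.Theorems.OverbindingBudgetBalancedCensusStatements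
open Summit.AtomisticToContinuum.Crystallization.Theorems.OverbindingBudgetAffineLadder
open Summit.AtomisticToContinuum.Crystallization.Theorems.OverbindingBudgetAffineMesoCut
open Summit.AtomisticToContinuum.Crystallization.Theorems.OverbindingBudgetAffinePhaseCut
open Summit.AtomisticToContinuum.Crystallization.Theorems.OverbindingBudgetAffineCushionCut
open Summit.AtomisticToContinuum.Crystallization.Theorems.OverbindingBudgetAffineTwinCut

variable {N : ℕ}

local notation "E3" => EuclideanSpace ℝ (Fin 3)

/-! ## §5  THE FAULT ZONE REFINED (PROVED): run ends reduce to run interiors by SHADOW PACKING; the THIN-FAULT GAS is the typed residual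

A fault-zone site `j` is a RUN END if its anchor ball holds a run-interior cubic letter `j′` within `rI·nn_j` (`rI = 5/2`: two layers), else a THIN
FAULT (for a deep `j`, taking the anchor `i = j`: no run-interior cubic letter within `5/2·nn_j`, i.e. `j` lies in a cubic run of length `≤ 4` —
twin `c`, intrinsic `cc`, extrinsic `ccc`, `cccc`).  In-window sites are `σ₁`-separated, so each run-interior site shadows `≤ 27(2·rI·σ₂+σ₁)³/σ₁³`
run ends (`card_le_of_cube` BY NAME, the fibre argument of g76's `mixedRoughCount_le_interfaceCubicCount`): **RunEnd ⟸ RunInterior**.  Hence the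
sharper lossless forms `HI ⟺ RunInterior ∧ ThinFault ⟺ RigidRunExchange ∧ CompressedRun ∧ WildRun ∧ ThinFault` and the competitor seam
`HI ⟸ StackSwapGain ∧ CompressedRun ∧ WildRun ∧ ThinFault`: modulo the swap certificate and B_aff-type wild / compressed run interiors, INTERFACE
DOMINANCE IS THE THIN-FAULT GAS. -/

/-- RUN-END fault-zone sites: cubic-lettered, a hexagonal letter within `rh·nn_j`, and an anchor `i` (deep, `j` in its `r`-ball, a hexagonal letter in
its `r`-ball) whose `r`-ball holds a RUN-INTERIOR cubic letter `j′` (no hexagonal letter within `rh·nn_{j′}`) with `dist (y j) (y j′) ≤ rI·nn_j`. -/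
noncomputable def runEndCount (ρ ε g r rh rI : ℝ) (y : Fin N → E3) : ℕ :=
  Nat.card {j : Fin N // (CFramed ε g y j ∧ ∃ i : Fin N, DeepReg ρ ε g y i ∧ dist (y j) (y i) ≤ r * nearestDist y i ∧ HNear r ε g y i ∧
      ∃ j' : Fin N, (CFramed ε g y j' ∧ ¬ HNear rh ε g y j') ∧ dist (y j') (y i) ≤ r * nearestDist y i ∧
        dist (y j) (y j') ≤ rI * nearestDist y j)
    ∧ HNear rh ε g y j}

/-- THIN-FAULT sites: fault-zone sites that are not run ends (no anchor ball holds a run-interior cubic letter within `rI·nn_j`) — the sites of cubic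
runs of length `≤ 4` in hexagonal matter: the residual normal form of interface dominance. -/
noncomputable def thinFaultCount (ρ ε g r rh rI : ℝ) (y : Fin N → E3) : ℕ :=
  Nat.card {j : Fin N // ((CFramed ε g y j ∧ ∃ i : Fin N, DeepReg ρ ε g y i ∧ dist (y j) (y i) ≤ r * nearestDist y i ∧ HNear r ε g y i)
      ∧ HNear rh ε g y j) ∧
    ¬ (∃ i : Fin N, DeepReg ρ ε g y i ∧ dist (y j) (y i) ≤ r * nearestDist y i ∧ HNear r ε g y i ∧
      ∃ j' : Fin N, (CFramed ε g y j' ∧ ¬ HNear rh ε g y j') ∧ dist (y j') (y i) ≤ r * nearestDist y i ∧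
        dist (y j) (y j') ≤ rI * nearestDist y j)}

/-- EXCLUDED MIDDLE ON THE RUN-INTERIOR WITNESS: `#faultZone ≤ #runEnd + #thinFault`. [this file] -/
theorem faultZoneCount_le_runEnd_add_thinFault {ρ ε g r rh rI : ℝ} (y : Fin N → E3) :
    faultZoneCount ρ ε g r rh y ≤ runEndCount ρ ε g r rh rI y + thinFaultCount ρ ε g r rh rI y := by
  simp only [faultZoneCount, runEndCount, thinFaultCount, Nat.card_eq_fintype_card, Fintype.card_subtype]
  calc (Finset.univ.filter fun j =>
          (CFramed ε g y j ∧ ∃ i : Fin N, DeepReg ρ ε g y i ∧ dist (y j) (y i) ≤ r * nearestDist y i ∧ HNear r ε g y i) ∧ HNear rh ε g y j).card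
      ≤ ((Finset.univ.filter fun j =>
            (CFramed ε g y j ∧ ∃ i : Fin N, DeepReg ρ ε g y i ∧ dist (y j) (y i) ≤ r * nearestDist y i ∧ HNear r ε g y i ∧
              ∃ j' : Fin N, (CFramed ε g y j' ∧ ¬ HNear rh ε g y j') ∧ dist (y j') (y i) ≤ r * nearestDist y i ∧
                dist (y j) (y j') ≤ rI * nearestDist y j) ∧ HNear rh ε g y j) ∪
          (Finset.univ.filter fun j =>
            ((CFramed ε g y j ∧ ∃ i : Fin N, DeepReg ρ ε g y i ∧ dist (y j) (y i) ≤ r * nearestDist y i ∧ HNear r ε g y i)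
              ∧ HNear rh ε g y j) ∧
            ¬ (∃ i : Fin N, DeepReg ρ ε g y i ∧ dist (y j) (y i) ≤ r * nearestDist y i ∧ HNear r ε g y i ∧
              ∃ j' : Fin N, (CFramed ε g y j' ∧ ¬ HNear rh ε g y j') ∧ dist (y j') (y i) ≤ r * nearestDist y i ∧
                dist (y j) (y j') ≤ rI * nearestDist y j))).card := by
        apply Finset.card_le_card
        intro j hj
        rw [Finset.mem_filter] at hj
        simp only [Finset.mem_union, Finset.mem_filter]
        by_cases hW : ∃ i : Fin N, DeepReg ρ ε g y i ∧ dist (y j) (y i) ≤ r * nearestDist y i ∧ HNear r ε g y i ∧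
            ∃ j' : Fin N, (CFramed ε g y j' ∧ ¬ HNear rh ε g y j') ∧ dist (y j') (y i) ≤ r * nearestDist y i ∧
              dist (y j) (y j') ≤ rI * nearestDist y j
        · exact Or.inl ⟨hj.1, ⟨hj.2.1.1, hW⟩, hj.2.2⟩
        · exact Or.inr ⟨hj.1, hj.2, hW⟩
    _ ≤ _ := Finset.card_union_le _ _

/-- `#runEnd ≤ #faultZone`. [this file] -/
theorem runEndCount_le_faultZoneCount {ρ ε g r rh rI : ℝ} (y : Fin N → E3) :
    runEndCount ρ ε g r rh rI y ≤ faultZoneCount ρ ε g r rh y := by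
  simp only [runEndCount, faultZoneCount, Nat.card_eq_fintype_card, Fintype.card_subtype]
  apply Finset.card_le_card
  intro j hj
  rw [Finset.mem_filter] at hj ⊢
  obtain ⟨-, ⟨hC, i, hD, hd, hH, -⟩, hN⟩ := hj
  exact ⟨Finset.mem_univ _, ⟨hC, i, hD, hd, hH⟩, hN⟩

/-- `#thinFault ≤ #faultZone`. [this file] -/
theorem thinFaultCount_le_faultZoneCount {ρ ε g r rh rI : ℝ} (y : Fin N → E3) :
    thinFaultCount ρ ε g r rh rI y ≤ faultZoneCount ρ ε g r rh y := by
  simp only [thinFaultCount, faultZoneCount, Nat.card_eq_fintype_card, Fintype.card_subtype]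
  apply Finset.card_le_card
  intro j hj
  rw [Finset.mem_filter] at hj ⊢
  exact ⟨hj.1, hj.2.1⟩

/-- `#thinFault ≤ #interfaceCubic`. [this file] -/
theorem thinFaultCount_le_interfaceCubicCount {ρ ε g r rh rI : ℝ} (y : Fin N → E3) :
    thinFaultCount ρ ε g r rh rI y ≤ interfaceCubicCount ρ ε g r y :=
  (thinFaultCount_le_faultZoneCount y).trans (faultZoneCount_le_interfaceCubicCount y)

/-- **SHADOW PACKING OF RUN ENDS ONTO RUN INTERIORS**: `#runEnd ≤ 27(2·rI·σ₂+σ₁)³/σ₁³ · #runInterior + #off` for `0 ≤ rI`, `0 < σ₁ ≤ σ₂` — an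
in-window run end `j` lies within `rI·nn_j ≤ rI·σ₂` of its run-interior witness `j′` (an interface site through the shared anchor), and in-window sites
are `σ₁`-separated (`card_le_of_cube` BY NAME; the fibre argument of g76's `mixedRoughCount_le_interfaceCubicCount`). [this file] -/
theorem runEndCount_le_runInteriorCount {ρ ε g r rh rI σ₁ σ₂ : ℝ} (hr0 : 0 ≤ rI) (hσ : 0 < σ₁) (hσσ : σ₁ ≤ σ₂)
    {y : Fin N → E3} (hy : Function.Injective y) :
    (runEndCount ρ ε g r rh rI y : ℝ)
      ≤ 27 / σ₁ ^ 3 * (2 * rI * σ₂ + σ₁) ^ 3 * runInteriorCount ρ ε g r rh y + offCount σ₁ σ₂ y := by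
  classical
  set K : ℝ := 27 / σ₁ ^ 3 * (2 * rI * σ₂ + σ₁) ^ 3 with hK
  set S : Finset (Fin N) := Finset.univ.filter
    (fun j => InWindow σ₁ σ₂ y j ∧
      ((CFramed ε g y j ∧ ∃ i : Fin N, DeepReg ρ ε g y i ∧ dist (y j) (y i) ≤ r * nearestDist y i ∧ HNear r ε g y i ∧
        ∃ j' : Fin N, (CFramed ε g y j' ∧ ¬ HNear rh ε g y j') ∧ dist (y j') (y i) ≤ r * nearestDist y i ∧
          dist (y j) (y j') ≤ rI * nearestDist y j) ∧ HNear rh ε g y j)) with hS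
  set B : Finset (Fin N) := Finset.univ.filter (fun j' =>
    (CFramed ε g y j' ∧ ∃ i : Fin N, DeepReg ρ ε g y i ∧ dist (y j') (y i) ≤ r * nearestDist y i ∧ HNear r ε g y i)
      ∧ ¬ HNear rh ε g y j') with hB
  set Of : Finset (Fin N) := Finset.univ.filter (fun i => ¬ InWindow σ₁ σ₂ y i) with hOf
  have hPc : runEndCount ρ ε g r rh rI y =
      (Finset.univ.filter fun j =>
        (CFramed ε g y j ∧ ∃ i : Fin N, DeepReg ρ ε g y i ∧ dist (y j) (y i) ≤ r * nearestDist y i ∧ HNear r ε g y i ∧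
          ∃ j' : Fin N, (CFramed ε g y j' ∧ ¬ HNear rh ε g y j') ∧ dist (y j') (y i) ≤ r * nearestDist y i ∧
            dist (y j) (y j') ≤ rI * nearestDist y j) ∧ HNear rh ε g y j).card := by
    rw [runEndCount, Nat.card_eq_fintype_card, Fintype.card_subtype]
  have hBc : runInteriorCount ρ ε g r rh y = B.card := by
    rw [runInteriorCount, Nat.card_eq_fintype_card, Fintype.card_subtype]
  have hOfc : offCount σ₁ σ₂ y = Of.card := by
    rw [offCount, Nat.card_eq_fintype_card, Fintype.card_subtype]
  -- split the run ends by the window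
  have hsplit : (Finset.univ.filter fun j =>
        (CFramed ε g y j ∧ ∃ i : Fin N, DeepReg ρ ε g y i ∧ dist (y j) (y i) ≤ r * nearestDist y i ∧ HNear r ε g y i ∧
          ∃ j' : Fin N, (CFramed ε g y j' ∧ ¬ HNear rh ε g y j') ∧ dist (y j') (y i) ≤ r * nearestDist y i ∧
            dist (y j) (y j') ≤ rI * nearestDist y j) ∧ HNear rh ε g y j).card
      ≤ S.card + Of.card := by
    calc (Finset.univ.filter fun j =>
          (CFramed ε g y j ∧ ∃ i : Fin N, DeepReg ρ ε g y i ∧ dist (y j) (y i) ≤ r * nearestDist y i ∧ HNear r ε g y i ∧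
            ∃ j' : Fin N, (CFramed ε g y j' ∧ ¬ HNear rh ε g y j') ∧ dist (y j') (y i) ≤ r * nearestDist y i ∧
              dist (y j) (y j') ≤ rI * nearestDist y j) ∧ HNear rh ε g y j).card
        ≤ (S ∪ Of).card := by
          apply Finset.card_le_card
          intro j hj
          rw [Finset.mem_filter] at hj
          rw [Finset.mem_union, Finset.mem_filter, Finset.mem_filter]
          by_cases hw : InWindow σ₁ σ₂ y j
          · exact Or.inl ⟨hj.1, hw, hj.2⟩
          · exact Or.inr ⟨hj.1, hw⟩
      _ ≤ S.card + Of.card := Finset.card_union_le _ _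
  -- the shadow fibres
  set T : Fin N → Finset (Fin N) := fun j' => S.filter (fun j => dist (y j) (y j') ≤ rI * σ₂) with hT
  have hcover : S ⊆ B.biUnion T := by
    intro j hj
    have hj' := (Finset.mem_filter.1 hj).2
    obtain ⟨⟨-, hhj⟩, ⟨-, i, hD, -, hH, j', ⟨hjC, hjN⟩, hd', hdj⟩, -⟩ := hj'
    rw [Finset.mem_biUnion]
    refine ⟨j', Finset.mem_filter.2 ⟨Finset.mem_univ _, ⟨hjC, i, hD, hd', hH⟩, hjN⟩, Finset.mem_filter.2 ⟨hj, ?_⟩⟩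
    exact hdj.trans (mul_le_mul_of_nonneg_left hhj hr0)
  have hfib : ∀ j' : Fin N, ((T j').card : ℝ) ≤ K := by
    intro j'
    have hcardim : ((T j').image y).card = (T j').card := Finset.card_image_of_injective _ hy
    set o : E3 := WithLp.toLp 2 (fun k : Fin 3 => (y j') k - rI * σ₂) with ho
    have hok : ∀ k : Fin 3, o k = (y j') k - rI * σ₂ := fun k => rfl
    have hmem : ∀ z ∈ (T j').image y, ∀ k : Fin 3, o k ≤ z k ∧ z k < o k + (2 * rI * σ₂ + σ₁) := by
      intro z hz k
      rw [Finset.mem_image] at hz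
      obtain ⟨j, hj, rfl⟩ := hz
      have hd : dist (y j) (y j') ≤ rI * σ₂ := (Finset.mem_filter.1 hj).2
      have hk : |(y j) k - (y j') k| ≤ dist (y j) (y j') := by
        rw [← Real.dist_eq]
        exact PiLp.dist_apply_le (y j) (y j') k
      have habs := abs_le.1 (hk.trans hd)
      rw [hok]
      constructor <;> linarith [habs.1, habs.2]
    have hsep : ∀ z ∈ (T j').image y, ∀ w ∈ (T j').image y, z ≠ w → σ₁ ≤ dist z w := by
      intro z hz w hw hzw
      rw [Finset.mem_image] at hz hw
      obtain ⟨j, hj, rfl⟩ := hz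
      obtain ⟨j₂, hj₂, rfl⟩ := hw
      have hjj : j₂ ≠ j := fun h => hzw (by rw [h])
      have hwin : InWindow σ₁ σ₂ y j := ((Finset.mem_filter.1 (Finset.mem_filter.1 hj).1).2).1
      exact hwin.1.trans (nearestDist_le_dist y hjj)
    have hrσ : 0 ≤ rI * σ₂ := mul_nonneg hr0 (by linarith)
    have h := card_le_of_cube (F := (T j').image y) (o := o) hσ (by linarith) hmem hsep
    rw [hcardim] at h
    rw [hK]
    exact h
  have h1 : S.card ≤ (B.biUnion T).card := Finset.card_le_card hcover
  have h2 : (B.biUnion T).card ≤ ∑ j' ∈ B, (T j').card := Finset.card_biUnion_le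
  have h3 : (∑ j' ∈ B, ((T j').card : ℝ)) ≤ ∑ j' ∈ B, K := Finset.sum_le_sum (fun j' _ => hfib j')
  rw [Finset.sum_const, nsmul_eq_mul] at h3
  have h12 : (S.card : ℝ) ≤ ∑ j' ∈ B, ((T j').card : ℝ) := by exact_mod_cast h1.trans h2
  have hSK : (S.card : ℝ) ≤ K * B.card := by
    calc (S.card : ℝ) ≤ B.card * K := h12.trans h3
      _ = K * B.card := by ring
  have hsplit' : (runEndCount ρ ε g r rh rI y : ℝ) ≤ S.card + Of.card := by rw [hPc]; exact_mod_cast hsplit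
  rw [hBc, hOfc]
  linarith

/-- **RunEnd_W**: `c > 0` per run-end fault-zone site against `#¬deep + #off + N^{2/3} + gains`. [this file · kind: statement · WEAKER than HI_W ·
PROVED FROM RunInterior_W (shadow packing)] -/
def BalancedRunEndGapW (ρ ε g r rh rI σ₁ σ₂ : ℝ) : Prop :=
  ∃ c C : ℝ, 0 < c ∧ ∀ (N : ℕ) (y : Fin N → E3), Function.Injective y →
    ∃ u : E3, ‖u‖ = 1 ∧
      (N : ℝ) * (⨅ Q : PeriodicConfiguration 3, Q.energyPerParticle lennardJones) + c * (runEndCount ρ ε g r rh rI y : ℝ)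
        - C * (notDeepCount ρ ε g y : ℝ) - C * (offCount σ₁ σ₂ y : ℝ) - C * (N : ℝ) ^ (2 / 3 : ℝ) - C * (dilGain y + shGain u y)
        ≤ interactionEnergy lennardJones y

/-- **ThinFault_W** «TF» — THE RESIDUAL: `c > 0` per thin-fault site against `#¬deep + #off + N^{2/3} + gains` («a dilute gas of thin cubic stacking faults
in hexagonal matter is never free»). [this file · kind: statement · WEAKER than HI_W · IDEA-NEEDED · INSTRUMENTABLE (SB-cert)] -/
def BalancedThinFaultGapW (ρ ε g r rh rI σ₁ σ₂ : ℝ) : Prop :=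
  ∃ c C : ℝ, 0 < c ∧ ∀ (N : ℕ) (y : Fin N → E3), Function.Injective y →
    ∃ u : E3, ‖u‖ = 1 ∧
      (N : ℝ) * (⨅ Q : PeriodicConfiguration 3, Q.energyPerParticle lennardJones) + c * (thinFaultCount ρ ε g r rh rI y : ℝ)
        - C * (notDeepCount ρ ε g y : ℝ) - C * (offCount σ₁ σ₂ y : ℝ) - C * (N : ℝ) ^ (2 / 3 : ℝ) - C * (dilGain y + shGain u y)
        ≤ interactionEnergy lennardJones y

/-- RunEnd (tame). -/
def TameBalancedRunEndGap (ρ ε g r rh rI : ℝ) : Prop :=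
  ∀ δ : ℝ, 0 < δ → δ ≤ 2 → BalancedRunEndGapW ρ ε g r rh rI δ 2

/-- ThinFault (tame). -/
def TameBalancedThinFaultGap (ρ ε g r rh rI : ℝ) : Prop :=
  ∀ δ : ℝ, 0 < δ → δ ≤ 2 → BalancedThinFaultGapW ρ ε g r rh rI δ 2

/-- **`RunEnd`** — at the literals of record, near-h radius `2`, witness radius `5/2`. [this file · kind: statement · WEAKER · PROVED FROM `RunInterior`] -/
def RunEnd : Prop :=
  TameBalancedRunEndGap 64 (3 / 50) (1 / 450) 12 2 (5 / 2)

/-- **`ThinFault`** «TF» — the thin-fault gas: the typed residual of interface dominance. [this file · kind: statement · WEAKER · IDEA-NEEDED] -/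
def ThinFault : Prop :=
  TameBalancedThinFaultGap 64 (3 / 50) (1 / 450) 12 2 (5 / 2)

/-- RunEnd_W is `CensusW`. [formal bookkeeping] -/
theorem balancedRunEndGapW_iff_censusW {ρ ε g r rh rI σ₁ σ₂ : ℝ} : BalancedRunEndGapW ρ ε g r rh rI σ₁ σ₂ ↔
    CensusW (fun y => runEndCount ρ ε g r rh rI y) (fun y => notDeepCount ρ ε g y) σ₁ σ₂ := Iff.rfl

/-- ThinFault_W is `CensusW`. [formal bookkeeping] -/
theorem balancedThinFaultGapW_iff_censusW {ρ ε g r rh rI σ₁ σ₂ : ℝ} : BalancedThinFaultGapW ρ ε g r rh rI σ₁ σ₂ ↔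
    CensusW (fun y => thinFaultCount ρ ε g r rh rI y) (fun y => notDeepCount ρ ε g y) σ₁ σ₂ := Iff.rfl

/-- **FaultZone_W ⇒ RunEnd_W**. [this file] -/
theorem balancedRunEndGapW_of_faultZoneW {ρ ε g r rh rI σ₁ σ₂ : ℝ} (h : BalancedFaultZoneGapW ρ ε g r rh σ₁ σ₂) :
    BalancedRunEndGapW ρ ε g r rh rI σ₁ σ₂ :=
  balancedRunEndGapW_iff_censusW.2 <|
    censusW_mono (fun y => runEndCount_le_faultZoneCount y) (fun _ => le_rfl) (balancedFaultZoneGapW_iff_censusW.1 h)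

/-- **FaultZone_W ⇒ ThinFault_W**. [this file] -/
theorem balancedThinFaultGapW_of_faultZoneW {ρ ε g r rh rI σ₁ σ₂ : ℝ} (h : BalancedFaultZoneGapW ρ ε g r rh σ₁ σ₂) :
    BalancedThinFaultGapW ρ ε g r rh rI σ₁ σ₂ :=
  balancedThinFaultGapW_iff_censusW.2 <|
    censusW_mono (fun y => thinFaultCount_le_faultZoneCount y) (fun _ => le_rfl) (balancedFaultZoneGapW_iff_censusW.1 h)

/-- **RunEnd_W ∧ ThinFault_W ⇒ FaultZone_W** (glued once). [this file] -/
theorem balancedFaultZoneGapW_of_runEnd_thinFault {ρ ε g r rh rI σ₁ σ₂ : ℝ}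
    (hE : BalancedRunEndGapW ρ ε g r rh rI σ₁ σ₂) (hT : BalancedThinFaultGapW ρ ε g r rh rI σ₁ σ₂) : BalancedFaultZoneGapW ρ ε g r rh σ₁ σ₂ :=
  balancedFaultZoneGapW_iff_censusW.2 <|
    censusW_glue (fun y => faultZoneCount_le_runEnd_add_thinFault y) (fun _ => Nat.le_add_right _ _)
      (balancedRunEndGapW_iff_censusW.1 hE) (balancedThinFaultGapW_iff_censusW.1 hT)

/-- **RunInterior_W ⇒ RunEnd_W** for `0 ≤ rI`, `0 < σ₁ ≤ σ₂` — the census form of the shadow packing (rate `c/(K+1)`, constant `max C 0 + c/(K+1)`;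
the arithmetic of g76's `balancedMixedRoughGapW_of_interfaceCubicGapW`). [this file] -/
theorem balancedRunEndGapW_of_runInteriorW {ρ ε g r rh rI σ₁ σ₂ : ℝ} (hr0 : 0 ≤ rI) (hσ : 0 < σ₁) (hσσ : σ₁ ≤ σ₂)
    (h : BalancedRunInteriorGapW ρ ε g r rh σ₁ σ₂) : BalancedRunEndGapW ρ ε g r rh rI σ₁ σ₂ := by
  obtain ⟨c, C, hc, h⟩ := h
  set K : ℝ := 27 / σ₁ ^ 3 * (2 * rI * σ₂ + σ₁) ^ 3 with hK
  have hb : 0 ≤ 2 * rI * σ₂ + σ₁ := by nlinarith [mul_nonneg hr0 (hσ.le.trans hσσ)]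
  have hK0 : 0 ≤ K := by rw [hK]; exact mul_nonneg (div_nonneg (by norm_num) (pow_nonneg hσ.le 3)) (pow_nonneg hb 3)
  have hK1 : 0 < K + 1 := by linarith
  set P : ℝ := max C 0 with hP
  have hP0 : 0 ≤ P := le_max_right _ _
  have hCP : C ≤ P := le_max_left _ _
  set c' : ℝ := c / (K + 1) with hc'
  have hc'0 : 0 < c' := by rw [hc']; positivity
  have hc'c : c' * K ≤ c := by
    rw [hc', div_mul_eq_mul_div, div_le_iff₀ hK1]
    nlinarith
  refine ⟨c', P + c', hc'0, fun N y hy => ?_⟩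
  obtain ⟨u, hu, e⟩ := h N y hy
  refine ⟨u, hu, ?_⟩
  have ha : (runEndCount ρ ε g r rh rI y : ℝ) ≤ K * runInteriorCount ρ ε g r rh y + offCount σ₁ σ₂ y := by
    rw [hK]; exact runEndCount_le_runInteriorCount hr0 hσ hσσ hy
  have n1 : (0 : ℝ) ≤ runInteriorCount ρ ε g r rh y := Nat.cast_nonneg _
  have n3 : (0 : ℝ) ≤ notDeepCount ρ ε g y := Nat.cast_nonneg _
  have n5 : (0 : ℝ) ≤ offCount σ₁ σ₂ y := Nat.cast_nonneg _
  have n6 : (0 : ℝ) ≤ (N : ℝ) ^ (2 / 3 : ℝ) := Real.rpow_nonneg (Nat.cast_nonneg _) _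
  have g1 : 0 ≤ dilGain y + shGain u y := add_nonneg (dilGain_nonneg y) (shGain_nonneg _ y)
  have e' : (N : ℝ) * (⨅ Q : PeriodicConfiguration 3, Q.energyPerParticle lennardJones) + c * (runInteriorCount ρ ε g r rh y : ℝ)
      - P * (notDeepCount ρ ε g y : ℝ) - P * (offCount σ₁ σ₂ y : ℝ) - P * (N : ℝ) ^ (2 / 3 : ℝ) - P * (dilGain y + shGain u y)
      ≤ interactionEnergy lennardJones y := by
    linarith [mul_le_mul_of_nonneg_right hCP n3, mul_le_mul_of_nonneg_right hCP n5, mul_le_mul_of_nonneg_right hCP n6,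
      mul_le_mul_of_nonneg_right hCP g1]
  have step1 : c' * (runEndCount ρ ε g r rh rI y : ℝ) ≤ c * runInteriorCount ρ ε g r rh y + c' * offCount σ₁ σ₂ y := by
    have h1 := mul_le_mul_of_nonneg_left ha hc'0.le
    have h2 : c' * K * (runInteriorCount ρ ε g r rh y : ℝ) ≤ c * runInteriorCount ρ ε g r rh y := mul_le_mul_of_nonneg_right hc'c n1
    linarith
  linarith [mul_nonneg hc'0.le n3, mul_nonneg hc'0.le n6, mul_nonneg hc'0.le g1]

/-- **FaultZone ⟺ RunEnd ∧ ThinFault** (LOSSLESS; both weaker). [this file] -/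
theorem faultZone_iff_runEnd_thinFault : FaultZone ↔ RunEnd ∧ ThinFault :=
  ⟨fun h => ⟨fun δ hδ hδ2 => balancedRunEndGapW_of_faultZoneW (h δ hδ hδ2), fun δ hδ hδ2 => balancedThinFaultGapW_of_faultZoneW (h δ hδ hδ2)⟩,
    fun h δ hδ hδ2 => balancedFaultZoneGapW_of_runEnd_thinFault (h.1 δ hδ hδ2) (h.2 δ hδ hδ2)⟩

/-- **RunInterior ⇒ RunEnd** (PROVED reduction: run ends are shadows of run interiors). [this file] -/
theorem runEnd_of_runInterior (h : RunInterior) : RunEnd :=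
  fun δ hδ hδ2 => balancedRunEndGapW_of_runInteriorW (by norm_num) hδ hδ2 (h δ hδ hδ2)

/-- **HI ⇒ ThinFault** (TF is weaker than HI). [this file] -/
theorem thinFault_of_interfaceDominance (h : InterfaceDominance) : ThinFault :=
  (faultZone_iff_runEnd_thinFault.1 (interfaceDominance_iff_run_fault.1 h).2).2

/-- **HI ⟺ RunInterior ∧ ThinFault** — interface dominance IS «run interiors are never free» plus «the thin-fault gas is never free». [this file] -/
theorem interfaceDominance_iff_runInterior_thinFault : InterfaceDominance ↔ RunInterior ∧ ThinFault :=
  ⟨fun h => ⟨(interfaceDominance_iff_run_fault.1 h).1, thinFault_of_interfaceDominance h⟩,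
    fun h => interfaceDominance_iff_run_fault.2 ⟨h.1, faultZone_iff_runEnd_thinFault.2 ⟨runEnd_of_runInterior h.1, h.2⟩⟩⟩

/-- **HI ⟺ RigidRunExchange ∧ CompressedRun ∧ WildRun ∧ ThinFault** — THE LOSSLESS LEAF FORM OF THE NODE. [this file] -/
theorem interfaceDominance_iff_leaves : InterfaceDominance ↔ RigidRunExchange ∧ CompressedRun ∧ WildRun ∧ ThinFault := by
  constructor
  · intro h
    obtain ⟨hE, hO, hX, -⟩ := interfaceDominance_iff_fourLeaves.1 h
    exact ⟨hE, hO, hX, thinFault_of_interfaceDominance h⟩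
  · rintro ⟨hE, hO, hX, hT⟩
    exact interfaceDominance_iff_runInterior_thinFault.2 ⟨runInterior_iff_mech.2 ⟨rigidRun_of_exchange hE hO hX, hO, hX⟩, hT⟩

/-- **THE COMPETITOR SEAM, SHARP FORM: StackSwapGain ∧ CompressedRun ∧ WildRun ∧ ThinFault ⇒ InterfaceDominance.** [this file] -/
theorem interfaceDominance_of_swap_thinFault (hT : StackSwapGain) (hO : CompressedRun) (hX : WildRun) (hF : ThinFault) : InterfaceDominance :=
  interfaceDominance_iff_leaves.2 ⟨rigidRunExchange_of_stackSwapGain hT, hO, hX, hF⟩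

/-- **MR of record from `QH ∧ RoughCubic ∧ StackSwapGain ∧ CompressedRun ∧ WildRun ∧ ThinFault`.** [this file] -/
theorem affMid_record_of_swap_thinFault (hQH : TameBalancedHexRoughGap 64 12 (1 / 10 ^ 5) (1 / 25) (3 / 50) (1 / 450) 12) (hQ : RoughCubic)
    (hT : StackSwapGain) (hO : CompressedRun) (hX : WildRun) (hF : ThinFault) :
    TameBalancedAffMidGap 64 12 (1 / 10 ^ 5) (1 / 25) (3 / 50) (1 / 450) :=
  affMid_record_of_roughCut hQH hQ (interfaceDominance_of_swap_thinFault hT hO hX hF)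

/-- MR of record from the LOSSLESS leaves `QH ∧ RoughCubic ∧ RigidRunExchange ∧ CompressedRun ∧ WildRun ∧ ThinFault`. [this file] -/
theorem affMid_record_of_leaves (hQH : TameBalancedHexRoughGap 64 12 (1 / 10 ^ 5) (1 / 25) (3 / 50) (1 / 450) 12) (hQ : RoughCubic)
    (hE : RigidRunExchange) (hO : CompressedRun) (hX : WildRun) (hF : ThinFault) :
    TameBalancedAffMidGap 64 12 (1 / 10 ^ 5) (1 / 25) (3 / 50) (1 / 450) :=
  affMid_record_of_roughCut hQH hQ (interfaceDominance_iff_leaves.2 ⟨hE, hO, hX, hF⟩)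

/-- **Slot-3 cone of record, sharp form** (HI from `StackSwapGain ∧ CompressedRun ∧ WildRun ∧ ThinFault`). [this file] -/
theorem tbdsg_of_swap_thinFault_record
    (hQH : TameBalancedHexRoughGap 64 12 (1 / 10 ^ 5) (1 / 25) (3 / 50) (1 / 450) 12) (hQ : RoughCubic)
    (hT : StackSwapGain) (hO : CompressedRun) (hX : WildRun) (hF : ThinFault)
    (hK : ∃ μ₁ μR : ℝ, 0 < μ₁ ∧ 0 < μR ∧ OverbindingBudgetAffineNearCluster.PureMarginStabilityAt (3 / 2000) μ₁ μR 4)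
    (hA : AffineChartStraightening)
    (hE : OverbindingBudgetAffineNearCluster.NearLightSkeletonEquilibrium (3 / 2000) 4 6 (1 / 1000) 12 (1 / 25) (1 / 2000) 4 6 320 12)
    (hC : OverbindingBudgetAffineNearCluster.NearPricedCoreFloor (3 / 2000) 4 6 (1 / 1000) 12 (1 / 25) (1 / 2000) (1 / (4 * 10 ^ 7) / 4) 4 6 12)
    (hS : OverbindingBudgetAffineNearCluster.NearPricedShellFloor (3 / 2000) 4 6 (1 / 1000) 12 (1 / 25) (1 / 2000) (1 / (4 * 10 ^ 7) / 4) 4 6 12)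
    (hV : OverbindingBudgetAffineNearCluster.ForceContentVisible (3 / 2000) 4 6 (1 / 1000) 12 (1 / 25) (1 / 2000) 4 6)
    (hN : OverbindingBudgetAffineNearCluster.NearSecondOrderFloor (3 / 2000) 4 6 (1 / 1000) 12 (1 / 25) (1 / 2000) (1 / (4 * 10 ^ 7)))
    (hFA : OverbindingBudgetAffineLocalisation.FarAggregatePricing 12 (1 / 25) (1 / 2000) (1 / (2 * 10 ^ 7)))
    (hFR : FineNonAffinity 12 (1 / 10 ^ 5) (1 / 25)) :
    TameBalancedDeepScaleGap (122 / 125) 0 4 (3 / 50) (1 / 450) :=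
  tbdsg_of_roughCut_record hQH hQ (interfaceDominance_of_swap_thinFault hT hO hX hF) hK hA hE hC hS hV hN hFA hFR

/-- **RDEF cone of record, sharp form** (HI from `StackSwapGain ∧ CompressedRun ∧ WildRun ∧ ThinFault`). [this file] -/
theorem rdef_of_ceg_shape_swap_thinFault_record
    (hCEG : Summit.AtomisticToContinuum.Crystallization.Theses.PricedLinkCensus.ChargedEnergyGap)
    (hSh : OverbindingBudgetTwoShellShape.TwoShellShape (1 / 100) (3 / 50) (1 / 450))
    (hQH : TameBalancedHexRoughGap 64 12 (1 / 10 ^ 5) (1 / 25) (3 / 50) (1 / 450) 12) (hQ : RoughCubic)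
    (hT : StackSwapGain) (hO : CompressedRun) (hX : WildRun) (hF : ThinFault)
    (hK : ∃ μ₁ μR : ℝ, 0 < μ₁ ∧ 0 < μR ∧ OverbindingBudgetAffineNearCluster.PureMarginStabilityAt (3 / 2000) μ₁ μR 4)
    (hA : AffineChartStraightening)
    (hE : OverbindingBudgetAffineNearCluster.NearLightSkeletonEquilibrium (3 / 2000) 4 6 (1 / 1000) 12 (1 / 25) (1 / 2000) 4 6 320 12)
    (hC : OverbindingBudgetAffineNearCluster.NearPricedCoreFloor (3 / 2000) 4 6 (1 / 1000) 12 (1 / 25) (1 / 2000) (1 / (4 * 10 ^ 7) / 4) 4 6 12)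
    (hS : OverbindingBudgetAffineNearCluster.NearPricedShellFloor (3 / 2000) 4 6 (1 / 1000) 12 (1 / 25) (1 / 2000) (1 / (4 * 10 ^ 7) / 4) 4 6 12)
    (hV : OverbindingBudgetAffineNearCluster.ForceContentVisible (3 / 2000) 4 6 (1 / 1000) 12 (1 / 25) (1 / 2000) 4 6)
    (hN : OverbindingBudgetAffineNearCluster.NearSecondOrderFloor (3 / 2000) 4 6 (1 / 1000) 12 (1 / 25) (1 / 2000) (1 / (4 * 10 ^ 7)))
    (hFA : OverbindingBudgetAffineLocalisation.FarAggregatePricing 12 (1 / 25) (1 / 2000) (1 / (2 * 10 ^ 7)))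
    (hFR : FineNonAffinity 12 (1 / 10 ^ 5) (1 / 25))
    (hTT : OverbindingBudgetGradedBareness.CleanlessExcessT) (hR : OverbindingBudgetCoherentCut.CoherentResidual 10) :
    Summit.AtomisticToContinuum.Crystallization.Theses.OverbindingBudget.RobustDefectLimitWindows :=
  rdef_of_ceg_shape_roughCut_record hCEG hSh hQH hQ (interfaceDominance_of_swap_thinFault hT hO hX hF) hK hA hE hC hS hV hN hFA hFR hTT hR

end Summit.AtomisticToContinuum.Crystallization.Theorems.OverbindingBudgetAffineRunCut
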